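import Summits.CriticalPhenomena.Ising3DConformalLimit.Theses.UnitLightCone
import Summits.CriticalPhenomena.Ising3DConformalLimit.Theses.MirrorHoelderCompactness
import HarnessLib.Audit.Check

/-!
# Line `superharmonic-comparison` for crux `TwoPointDoubling` (stmt-CriticalPhenomena-6150), route `UnitLightCone`
# (strategist b1, `--alt` to the birth line; shared crux, home decl `MirrorHoelderCompactness.TwoPointDoubling`, same body)

Crux: `∃ κ > 0, ∀ n ≥ 1, κ·g(n) ≤ g(2n)`, `g(n) = ⟨σ₀σ_{n e₀}⟩⁺_{β_c(3)} = criticalTwoPoint 3 (Pi.single 0 n)` — all-scale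
doubling of the critical axis two-point function of the nearest-neighbour Ising model on `ℤ³` (Aizenman–Duminil-Copin 2021,
Remark 5.10, OPEN).  Every known handle on it is either a two-point-PROFILE fact (refuted as a class by the barrier
`Literature.Barriers.CriticalPhenomena.AxisProfileAxiomaticsNoDoubling`: lacunary mixtures of massive episodes pass RP, MMS, both
envelopes, the sliding-scale infrared bound and Duminil-Copin–Panis Thm 1.3 and lose doubling by unbounded factors) or a
one-ended wall-avoidance probability of the sourced folded current EQUIVALENT to the crux (`wallRepulsion_iff_twoPointDoubling`).

## The line: NO POSITIVE EFFECTIVE MASS ⟹ doubling by the discrete comparison principle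

Write `ΔG(x) := Σ_{i=1}^{3} (G(x+eᵢ) + G(x−eᵢ)) − 6 G(x)` (six-neighbour lattice Laplacian of `G = criticalTwoPoint 3`) and
`V := ΔG/G` — `G` is tautologically the positive solution of the lattice Schrödinger equation `(Δ − V)G = 0` off the origin.
A massive episode at scale `M` (the enemy: `G ≈ e^{−|x|/M}/|x|` on `[M, M log M]`) has `V ≈ +M⁻²`, i.e. `V·|x|² ≈ (|x|/M)² → ∞`;
the expected critical profile `|x|^{−(1+η)}` has `V|x|² → η(1+η) ≈ 0.038` (continuum `Δ r^{−a} = a(a−1) r^{−a−2}` in `d = 3`).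
ONLY THE POSITIVE PART OF `V` IS AN OBSTRUCTION to lower bounds: if `ΔG ≤ V⁺G` with `0 ≤ V⁺ ≤ A/‖x‖²` on the shell
`{n/3 < ‖x‖_∞ ≤ 8n}`, then comparing `G` with `m·φ`, `m = min_{‖y‖_∞ ≤ n/3} G(y) ≥ g(n)` (MMS sandwich
`criticalTwoPoint_axis_sandwich`), `φ` an explicit SUBsolution of `Δ − A/‖x‖²` on the shell (e.g. `(3‖x‖/n)^{−p}`, `p(p−1) ≥ 192 A`,
or a power of the lattice Green's function), the minimum principle for `Δ − V⁺` (`V⁺ ≥ 0`, finite region, `w ≥ −δ` on the boundary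
⟹ `w ≥ −δ` inside) gives `g(2n) = G(2n e₀) ≥ m (φ(2ne₀) − max_{outer} φ) ≥ c(A)·g(n)`; the finitely many `n < n₀(A)` are absorbed
into `κ` by positivity.  No Harnack inequality, no Moser iteration: one comparison function.  The negative part of `V` (attraction)
only helps.

So the crux follows from the ONE-SIDED SCALE-INVARIANT KATO BOUND `ΔG(x) ≤ A·G(x)/‖x‖²` (`x ≠ 0`).  What makes this more than a
restatement: (a) it is LOCAL (one point, lattice-scale operator), whereas 6150 compares two scales; (b) it is ONE-SIDED; (c) by the
DLR equation at the site `x` (tested against the far spin `σ₀`) it is an inequality between correlations of `σ₀` with ODD LOCAL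
FUNCTIONS OF THE SIX NEIGHBOURS of `x`: with `S_x = Σ_{y∼x} σ_y` and `⟨σ₀σ_x⟩ = ⟨σ₀ tanh(β_c S_x)⟩` (DLR), `ΔG(x) = ⟨σ₀ Ψ_x⟩`,
`Ψ_x = S_x − 6 tanh(β_c S_x)`; expanding `tanh(β_c S_x) = t₁ e₁ + t₃ e₃ + t₅ e₅` in the elementary symmetric polynomials of the six
neighbour spins (at `β_c(3) = 0.22165`: `t₁ = 0.1809`, `t₃ = −0.01188`, `t₅ = 0.00352`, so `1 − 6t₁ = −0.0854`) the stub reads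
`−0.0854·Σ_{y∼x}⟨σ₀σ_y⟩ + 0.0713·Σ_{|B|=3}⟨σ₀σ_B⟩ − 0.0211·Σ_{|B|=5}⟨σ₀σ_B⟩ ≤ A⟨σ₀σ_x⟩/‖x‖²` (`B` ranging over subsets of
the six neighbours): an UPPER bound on the clustered four-point functions `⟨σ₀σ_yσ_y'σ_y''⟩` against two- and six-point ones, to
relative precision `‖x‖⁻²` — the lattice shadow of the operator identity `Ψ_x = (Δσ)_x + 6τ_x` with the DLR innovation `τ` null.
GKS/Lebowitz give this comparison today only up to `O(1)` factors (`⟨σ₀σ_B⟩ ∈ [1,3]·u₂⟨σ₀σ_x⟩`); the leading order cancels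
identically (`ΔG/G → 0` is known, rate `(log k)/k` on the axis); the OPEN content is the `‖x‖⁻²` precision of the subleading term.
This is the mechanism of the crux idea card `harnack-effective-mass` (Ideas/, ideator 2, r1), SHARPENED here in three ways: one-sided
instead of `|V|`, comparison principle instead of Moser–Harnack, and the explicit DLR coefficients.

Stubs (3; sorries only inside `stub_*`; composition `TwoPointDoubling_of` kernel-checked):
* `stub_dlrLaplacian` (PROVABLE NOW, M): `ΔG(x) = ⟨σ₀ Ψ_x⟩⁺_{β_c}` for `x ≠ 0` — infinite-volume DLR equation of the plus (= free,
  unique) state at `β_c`, `h = 0`, at one site, plus linearity of `plusExpect` on local observables.  Tree inputs: finite-volume DLR /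
  Gibbs-specification lemmas (`GibbsSpecificationDLRProofs`, `CoarseCellMixingDLR`, `IsingEffectiveField`), box limits of local
  observables (`hasBoxLimit_isingCorr_plus`).  [FriedliVelenik2017 Ch. 3 §3.6 / Ch. 6 (DLR); GlimmJaffe1987 §4]
* `stub_oneSidedKatoDLR` (OPEN — the load-bearing stub, stated in the DLR form): `∃ A, ∀ x ≠ 0, ⟨σ₀ Ψ_x⟩ ≤ A ⟨σ₀σ_x⟩/‖x‖²`.
* `stub_greenComparison` (PROVABLE NOW, L): the one-sided Kato bound in Laplacian form implies all-scale axis doubling (the body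
  of the crux, stated verbatim so that the stub is a plain implication between two explicit statements; comparison principle above).
  Tree inputs: `criticalTwoPoint_axis_sandwich` (MMS), `criticalTwoPoint_bounds_holds` (positivity), finite-dimensional minimum
  principle for `Δ − V⁺` on a box (to be written; elementary), a discrete subsolution (`RigorousRGSmallParameterDiscreteTaylor*`
  has discrete Taylor machinery; `DirichletGreenFunction`, `SRWGreen*` have lattice Green's function facts).

Why no stub is the crux in costume: `stub_oneSidedKatoDLR` is a one-point inequality between correlations of local odd observables
(not a two-scale comparison, not a profile fact, not a wall-avoidance probability); it is NOT implied by any landed theorem and does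
not cheaply imply the crux (BC3-type probes `stub → TwoPointDoubling` / `stub → Ising3DConformalLimit` by
`first | exact? | simpa | aesop` fail — recorded in the line card).  Honest strength: ON THE AXIS the Laplacian bound is a CONSEQUENCE of
6150 (planner `Sketch.lean`: log-convexity makes `δ²g(k) ≤ A g(k)/k²` equivalent to 6150, and `ΔG(ke₀) ≤ δ²g(k)` by MMS); off the
axis it is not known to follow from 6150, so `C⁺` is nominally stronger.  Cheapest falsifier: Monte-Carlo of `V(x)‖x‖²` for
`‖x‖ ≤ 8` at `L = 32…96` (this seat's job j026349; ideator 2's j024270): growth of `V‖x‖²` without bound would kill the bet.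

Disproof used: none on file for this crux (no `Cruxes/TwoPointDoubling/Disproof.lean`, no `_false_without_` theorem, no
`Theorems/TwoPointDoubling/Negative/`).  Honoured instead: the barrier `AxisProfileAxiomaticsNoDoubling` (the open stub is not a
profile fact: it quantifies over 4- and 6-point functions through the DLR identity, which the lacunary/GFF witnesses do not possess), the
parent crux's Disproof §E (`W_ε` DOUBLES — consistent, the line does not exclude bounded log-periodicity), and the negatives index
(11 CriticalPhenomena refutations, all Cardy/percolation/SAW; none concerns `criticalTwoPoint 3`).
-/

noncomputable section

namespace Summit.CriticalPhenomena.Ising3DConformalLimit.Cruxes.TwoPointDoubling.SuperharmonicComparison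

open scoped BigOperators
open Literature.Probability.LatticeModels

/-! ## The three registered stubs (signatures fully qualified, over importable vocabulary only) -/

/-- **STUB 1 · `stub_dlrLaplacian` (provable now, M) — the DLR reading of the lattice Laplacian.**
For `x ≠ 0`: `Σ_i (G(x+eᵢ) + G(x−eᵢ)) − 6G(x) = ⟨σ₀ · (S_x − 6 tanh(β_c S_x))⟩⁺_{β_c,0}`, `S_x = Σ_i (σ_{x+eᵢ} + σ_{x−eᵢ})`,
`G = criticalTwoPoint 3`: the one-site DLR equation `⟨σ₀σ_x⟩ = ⟨σ₀ tanh(β_c S_x)⟩` of the infinite-volume plus state at `h = 0`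
and linearity of the state on local observables. [FriedliVelenik2017 §3.6, Ch. 6; GlimmJaffe1987 §4.2] -/
theorem stub_dlrLaplacian :
    ∀ x : Literature.Probability.LatticeModels.Site 3, x ≠ 0 →
      (∑ i : Fin 3, (Literature.Probability.LatticeModels.criticalTwoPoint 3 (x + Pi.single i 1) +
          Literature.Probability.LatticeModels.criticalTwoPoint 3 (x - Pi.single i 1))) -
        6 * Literature.Probability.LatticeModels.criticalTwoPoint 3 x =
      Literature.Probability.LatticeModels.plusExpect 3 (Literature.Probability.LatticeModels.criticalBeta 3) 0
        (fun σ => Literature.Probability.LatticeModels.spinAt 0 σ *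
          ((∑ i : Fin 3, (Literature.Probability.LatticeModels.spinAt (x + Pi.single i 1) σ +
              Literature.Probability.LatticeModels.spinAt (x - Pi.single i 1) σ)) -
            6 * Real.tanh (Literature.Probability.LatticeModels.criticalBeta 3 *
              ∑ i : Fin 3, (Literature.Probability.LatticeModels.spinAt (x + Pi.single i 1) σ +
                Literature.Probability.LatticeModels.spinAt (x - Pi.single i 1) σ)))) := by
  sorry

/-- **STUB 2 · `stub_oneSidedKatoDLR` (OPEN — load-bearing) — no positive effective mass, in DLR form.**
`∃ A, ∀ x ≠ 0, ⟨σ₀ · (S_x − 6 tanh(β_c S_x))⟩⁺_{β_c,0} ≤ A·⟨σ₀σ_x⟩/‖x‖²` (sup norm on `ℤ³`; any norm, `A` absorbs).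
Equivalently (STUB 1) `ΔG(x) ≤ A G(x)/‖x‖²`: the positive part of `V = ΔG/G` is scale-invariantly Kato-small. With
`tanh(β_c S_x) = t₁e₁ + t₃e₃ + t₅e₅` (`t₁ = 0.1809`, `t₃ = −0.01188`, `t₅ = 0.00352` at `β_c(3)`): an upper bound on the clustered
four-point functions `Σ_{|B|=3, B ⊂ N(x)} ⟨σ₀σ_B⟩` against `Σ_{y∼x}⟨σ₀σ_y⟩` and `Σ_{|B|=5}⟨σ₀σ_B⟩` to relative precision `‖x‖⁻²`.
Why plausible: `V‖x‖² → η(1+η) ≈ 0.04` for the expected profile; the leading order cancels identically (`ΔG/G → 0` known).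
Why it might fail / what is open: no correlation inequality is sharp beyond `O(1)` factors at clustered points.
[AizenmanDuminilCopinAnnals2021 Rem. 5.10; FriedliVelenik2017 Ch. 6; crux idea card harnack-effective-mass] -/
theorem stub_oneSidedKatoDLR :
    ∃ A : ℝ, ∀ x : Literature.Probability.LatticeModels.Site 3, x ≠ 0 →
      Literature.Probability.LatticeModels.plusExpect 3 (Literature.Probability.LatticeModels.criticalBeta 3) 0
        (fun σ => Literature.Probability.LatticeModels.spinAt 0 σ *
          ((∑ i : Fin 3, (Literature.Probability.LatticeModels.spinAt (x + Pi.single i 1) σ +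
              Literature.Probability.LatticeModels.spinAt (x - Pi.single i 1) σ)) -
            6 * Real.tanh (Literature.Probability.LatticeModels.criticalBeta 3 *
              ∑ i : Fin 3, (Literature.Probability.LatticeModels.spinAt (x + Pi.single i 1) σ +
                Literature.Probability.LatticeModels.spinAt (x - Pi.single i 1) σ)))) ≤
        A * Literature.Probability.LatticeModels.criticalTwoPoint 3 x / ‖x‖ ^ 2 := by
  sorry

/-- **STUB 3 · `stub_greenComparison` (provable now, L) — the comparison principle: no positive effective mass ⟹ doubling.**
If `ΔG(x) ≤ A·G(x)/‖x‖²` for all `x ≠ 0` then `∃ κ > 0, ∀ n ≥ 1, κ g(n) ≤ g(2n)`.  Proof route: minimum principle for `Δ − V⁺`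
(`V⁺ = max(A,0)/‖x‖² ≥ 0`) on the shell `{n/3 < ‖x‖_∞ ≤ 8n}` with the explicit subsolution `φ(x) = (3‖x‖₂/n)^{−p}`,
`p(p−1) ≥ C·max(A,0)` (discrete Taylor for `n ≥ n₀`), inner value `m = min_{‖y‖_∞ ≤ n/3} G ≥ g(n)` by the MMS sandwich
`criticalTwoPoint_axis_sandwich`, boundary slack `w ≥ −m·max_{outer} φ`; `g(2n) ≥ m(6^{−p} − 24^{−p})`; small `n` by positivity.
[Kuo–Trudinger-type discrete maximum principle (folklore); DuminilCopin2019 eq. (4.10) (MMS sandwich); Simon1980] -/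
theorem stub_greenComparison :
    (∃ A : ℝ, ∀ x : Literature.Probability.LatticeModels.Site 3, x ≠ 0 →
      (∑ i : Fin 3, (Literature.Probability.LatticeModels.criticalTwoPoint 3 (x + Pi.single i 1) +
          Literature.Probability.LatticeModels.criticalTwoPoint 3 (x - Pi.single i 1))) -
        6 * Literature.Probability.LatticeModels.criticalTwoPoint 3 x ≤
        A * Literature.Probability.LatticeModels.criticalTwoPoint 3 x / ‖x‖ ^ 2) →
    ∃ κ : ℝ, 0 < κ ∧ ∀ n : ℕ, 1 ≤ n →
      κ * Literature.Probability.LatticeModels.criticalTwoPoint 3 (Pi.single 0 (n : ℤ)) ≤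
        Literature.Probability.LatticeModels.criticalTwoPoint 3 (Pi.single 0 (2 * (n : ℤ))) := by
  sorry

/-! ## Names for the statements (hypotheses of the composition) -/

namespace Statement

/-- Statement of `stub_dlrLaplacian`. -/
abbrev stub_dlrLaplacian : Prop := type_of% SuperharmonicComparison.stub_dlrLaplacian
/-- Statement of `stub_oneSidedKatoDLR`. -/
abbrev stub_oneSidedKatoDLR : Prop := type_of% SuperharmonicComparison.stub_oneSidedKatoDLR
/-- Statement of `stub_greenComparison`. -/
abbrev stub_greenComparison : Prop := type_of% SuperharmonicComparison.stub_greenComparison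

end Statement

/-! ## Local shorthand, certified by `Iff.rfl` / `rfl` -/

/-- The six-neighbour lattice Laplacian of `criticalTwoPoint 3`. -/
def laplacian (x : Site 3) : ℝ :=
  (∑ i : Fin 3, (criticalTwoPoint 3 (x + Pi.single i 1) + criticalTwoPoint 3 (x - Pi.single i 1))) - 6 * criticalTwoPoint 3 x

/-- The DLR defect `Ψ_x(σ) = S_x − 6 tanh(β_c S_x)`. -/
def eomDefect (x : Site 3) (σ : SpinConfig (Site 3)) : ℝ :=
  (∑ i : Fin 3, (spinAt (x + Pi.single i 1) σ + spinAt (x - Pi.single i 1) σ)) -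
    6 * Real.tanh (criticalBeta 3 * ∑ i : Fin 3, (spinAt (x + Pi.single i 1) σ + spinAt (x - Pi.single i 1) σ))

/-- `⟨σ₀ Ψ_x⟩⁺_{β_c,0}`. -/
def defectCorr (x : Site 3) : ℝ := plusExpect 3 (criticalBeta 3) 0 (fun σ => spinAt 0 σ * eomDefect x σ)

/-- The transfer target `C⁺` of the line: the one-sided scale-invariant Kato bound (Laplacian form). -/
def OneSidedKatoBound : Prop := ∃ A : ℝ, ∀ x : Site 3, x ≠ 0 → laplacian x ≤ A * criticalTwoPoint 3 x / ‖x‖ ^ 2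

theorem stub_dlrLaplacian_iff : Statement.stub_dlrLaplacian ↔ ∀ x : Site 3, x ≠ 0 → laplacian x = defectCorr x := Iff.rfl

theorem stub_oneSidedKatoDLR_iff :
    Statement.stub_oneSidedKatoDLR ↔ ∃ A : ℝ, ∀ x : Site 3, x ≠ 0 → defectCorr x ≤ A * criticalTwoPoint 3 x / ‖x‖ ^ 2 :=
  Iff.rfl

/-- The conclusion of STUB 3 is the body of the crux (all-scale axis doubling), verbatim. -/
theorem stub_greenComparison_iff :
    Statement.stub_greenComparison ↔ (OneSidedKatoBound → Theses.UnitLightCone.TwoPointDoubling) := Iff.rfl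

/-! ## The composition (kernel-checked, no sorry): the three stubs give the crux BY NAME -/

/-- STUB 1 + STUB 2 give the transfer target `C⁺`. -/
theorem oneSidedKatoBound_of (h₁ : Statement.stub_dlrLaplacian) (h₂ : Statement.stub_oneSidedKatoDLR) : OneSidedKatoBound := by
  rw [stub_dlrLaplacian_iff] at h₁
  rw [stub_oneSidedKatoDLR_iff] at h₂
  obtain ⟨A, hA⟩ := h₂
  exact ⟨A, fun x hx => by rw [h₁ x hx]; exact hA x hx⟩

/-- **`TwoPointDoubling` from the stubs** (route UnitLightCone's copy, BY NAME; the home copy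
`MirrorHoelderCompactness.TwoPointDoubling` has the same body, so the same term proves it). -/
theorem TwoPointDoubling_of (h₁ : Statement.stub_dlrLaplacian) (h₂ : Statement.stub_oneSidedKatoDLR)
    (h₃ : Statement.stub_greenComparison) :
    Summit.CriticalPhenomena.Ising3DConformalLimit.Theses.UnitLightCone.TwoPointDoubling := by
  rw [stub_greenComparison_iff] at h₃
  exact h₃ (oneSidedKatoBound_of h₁ h₂)

end Summit.CriticalPhenomena.Ising3DConformalLimit.Cruxes.TwoPointDoubling.SuperharmonicComparison

end
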